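import Summits.RiemannHypothesis.RiemannHypothesis.Theorems.MotivicDoorAWSStructure
import Summits.RiemannHypothesis.RiemannHypothesis.Theorems.MotivicDoor.AWS.SmallTestEstimate
import Summits.RiemannHypothesis.RiemannHypothesis.Theorems.WeilGroundStateGroundStatesConvergeToXiUniformBound
import Literature.NumberTheory.LFunctions.WeilWindowSimpleEven
import Literature.NumberTheory.LFunctions.WeilWindowSuzukiContinuityProofs

/-!
# Forcing from a generating family: RH ⟺ Weil positivity on the integer span of ANY `C¹`-dense family

AWS sprint (cell `pub-rhdoor`), forcing lemma, owner cc-4.  The structure-level nodes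
`WeilPositivityForcing` / `RiemannHypothesisOfArithmeticWeilSurface` of `MotivicDoorAWSStructure` were
closed first by seat aws-3 (`Summits/RiemannHypothesis/MotivicDoor/AWS/ForcingDown.lean`, p196720, via
`CcDataContinuous`).  THIS FILE isolates the forcing mechanism from the lattice: it needs NO
arithmetic Weil surface, NO intersection pairing and NO continuity statement as a hypothesis — only a
generating family `G` (real test functions `φ_i` with the `C¹`-window density property) and the SIGN of
Weil's form on the countable set of integer combinations `u_c = Σ c_i φ_i`.

HONEST LABEL (carried on every AWS file): the sprint theorem `Nonempty ArithmeticWeilSurface → RH` is a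
one-way implication from a strengthened, prime-side-only axiom system; the existence of such an object
is NOT claimed and is the located gap (satisfiability equivalent to RH; forward direction by forcing).
The theorems below are UNCONDITIONAL equivalences / implications; none asserts RH.  Framing: lottery
ticket at the motivic door; RH probability negligible; consolation prizes are real: a new semi-local
Weil-positivity theorem, or a located gap in the Connes–Consani programme, plus the ff-door theorem.

## Main results (0 sorry; axioms `propext`, `Classical.choice`, `Quot.sound`)

* `re_weilQuadratic_nonneg_of_generatingFamily` — **FORCING**: if `Re Q(u_c) ≥ 0` for every integer
  combination `u_c` of a generating family `G`, then `Re Q(u) ≥ 0` for EVERY real test function `u`.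
  Mechanism: homogeneity (`weilQuadratic_const_mul`) for the rational multiples `N⁻¹ u_c`; for an
  approximant `v` of `u` with `w = v − u` `C¹`-small on the window, polarisation (`weilQuadratic_add`)
  and the reality swap give `Re Q(u) = Re Q(v) − Re Q(w) − 2 Re W(w ⋆ ũ)`; the cross term is `O(ε)` by
  the tree's uniform bound for the polarised functional at FIXED `u`
  (`norm_weilFunctional_weilConv_weilReflect_le`) and `Re Q(w) ≤ K_R ε²` by
  `exists_re_weilQuadratic_le` (`AWS/SmallTestEstimate.lean`, Markov decomposition).
* `weilPositivity_of_generatingFamily`, `riemannHypothesis_of_generatingFamily` — hence Weil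
  positivity and RH (`weilPositivity_iff_real`, `weil_criterion_holds`).
* `riemannHypothesis_iff_nonneg_on_generatingFamily` — **RH ⟺ `Re W(u_c ⋆ ũ_c) ≥ 0` for all
  `c : G.ι →₀ ℤ`**, for ANY generating family `G`: a countable list of explicit prime-side inequalities
  (each a finite computation in the primes `p^k < e^{2R}` and the archimedean kernel) equivalent to RH.
* `riemannHypothesis_iff_castelnuovoSeveri_on_generatingFamily` — the same in the Connes–Consani
  normalisation: RH ⟺ `D(f_c)·D(f_c) ≤ 2 (D·e₁)(D·e₂)`, i.e. `2 𝔰(f_c,f_c) ≤ 2 (∫ f_c d*u)(∫ f_c du)`,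
  for the countably many "divisors" `D(f_c)`, `f_c = toMul u_c` (`ccPairing_le_masses_iff`).

What this says about the sprint's axiom system (REFEREE question "one node, not two"): the density
axiom `GeneratingFamily.dense` carries NO arithmetic — it is a property of the functions `φ_i` alone —
and the whole content of `Nonempty ArithmeticWeilSurface` beyond bookkeeping is the SIGN CONDITION on
the integer span of the generators, which by this file is already equivalent to RH.

References: A. Weil (1952); E. Bombieri, Rend. Mat. Acc. Lincei (9) 11 (2000), Thm 2;
A. Connes, C. Consani, arXiv:1805.10501 §3.1 (15)–(17).
-/

noncomputable section

open Complex Set MeasureTheory Filter Literature.NumberTheory.LFunctions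
open Literature.NumberTheory.ConnesConsani2019
open Summit.RiemannHypothesis.RiemannHypothesis.Theorems.GroundStatesConvergeToXi
open Summit.RiemannHypothesis.RiemannHypothesis.Theorems.MotivicDoor.ConnesConsani
open scoped Real Topology ComplexConjugate ArithmeticFunction.vonMangoldt ContDiff

namespace Summit.RiemannHypothesis.RiemannHypothesis.Theorems.MotivicDoor.AWS

/-! ## Integer combinations of a generating family are test functions -/

/-- An integer combination `u_c = Σ c_i φ_i` of the generators is a (real) Weil test function. -/
theorem GeneratingFamily.isWeilTest_testCombination (G : GeneratingFamily) (c : G.ι →₀ ℤ) :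
    IsWeilTest fun t ↦ (testCombination G.φ c t : ℂ) := by
  classical
  have key : ∀ s : Finset G.ι,
      IsWeilTest fun t ↦ ∑ i ∈ s, ((c i : ℝ) : ℂ) * (G.φ i t : ℂ) := by
    intro s
    induction s using Finset.induction_on with
    | empty =>
      simp only [Finset.sum_empty]
      change IsWeilTest (0 : ℝ → ℂ)
      exact ⟨contDiff_const, HasCompactSupport.zero⟩
    | insert i s hi ih =>
      simpa [Finset.sum_insert hi, Pi.add_def] using
        ((G.isWeilTest i).const_mul ((c i : ℝ) : ℂ)).add ih
  convert key c.support using 2 with t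
  simp [testCombination, Finsupp.sum, Complex.ofReal_sum, Complex.ofReal_mul]

/-! ## FORCING: positivity on the integer span of a generating family forces Weil positivity -/

/-- **FORCING LEMMA (family form).**  If Weil's quadratic form is non-negative on every integer
combination of a generating family, it is non-negative on every real test function. -/
theorem re_weilQuadratic_nonneg_of_generatingFamily (G : GeneratingFamily)
    (hpos : ∀ c : G.ι →₀ ℤ, 0 ≤ (weilQuadratic fun t ↦ (testCombination G.φ c t : ℂ)).re)
    {u : ℝ → ℝ} (hu : IsWeilTest fun t ↦ (u t : ℂ)) :
    0 ≤ (weilQuadratic fun t ↦ (u t : ℂ)).re := by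
  by_contra hneg
  rw [not_le] at hneg
  -- the window, the two constants, the tolerance
  obtain ⟨R, hRpos, hsuppu, hdense⟩ := G.dense u hu
  have hR : 0 ≤ R := hRpos.le
  obtain ⟨C, hC0, hC⟩ :=
    norm_weilFunctional_weilConv_weilReflect_le (h₀ := fun t ↦ (u t : ℂ)) hu (b₀ := 1) (by norm_num)
  obtain ⟨K, hK0, hK⟩ := exists_re_weilQuadratic_le hR
  set q : ℝ := -(weilQuadratic fun t ↦ (u t : ℂ)).re with hq
  have hqpos : 0 < q := by rw [hq]; linarith
  set L : ℝ := K + 4 * C * R * Real.exp R with hL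
  have hL0 : 0 ≤ L := by positivity
  set ε : ℝ := min 1 (q / (L + 1)) with hεdef
  have hεpos : 0 < ε := lt_min one_pos (div_pos hqpos (by linarith))
  have hε1 : ε ≤ 1 := min_le_left _ _
  have hεL : ε * L < q := by
    have h1 : ε ≤ q / (L + 1) := min_le_right _ _
    have h2 : ε * (L + 1) ≤ q := by rwa [le_div_iff₀ (by linarith)] at h1
    nlinarith
  -- the approximant `v = N⁻¹ u_c` and the error `w = v − u`
  obtain ⟨N, c, hN, hsc, happ0, happ1⟩ := hdense ε hεpos
  set v : ℝ → ℝ := fun t ↦ (N : ℝ)⁻¹ * testCombination G.φ c t with hvdef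
  have hv : IsWeilTest fun t ↦ (v t : ℂ) := by
    have h := (G.isWeilTest_testCombination c).const_mul (((N : ℝ)⁻¹ : ℝ) : ℂ)
    convert h using 1
    funext t
    simp [hvdef]
  have hQv : 0 ≤ (weilQuadratic fun t ↦ (v t : ℂ)).re := by
    have h := weilQuadratic_const_mul (((N : ℝ)⁻¹ : ℝ) : ℂ) (fun t ↦ (testCombination G.φ c t : ℂ))
    have hfun : (fun t ↦ (v t : ℂ)) = fun t ↦ (((N : ℝ)⁻¹ : ℝ) : ℂ) * (testCombination G.φ c t : ℂ) := by
      funext t; simp [hvdef]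
    rw [hfun, h, Complex.re_ofReal_mul]
    exact mul_nonneg (Complex.normSq_nonneg _) (hpos c)
  have hu0 : ∀ t, t ∉ Icc (-R) R → u t = 0 := fun t ht ↦
    image_eq_zero_of_notMem_tsupport fun h ↦ ht (hsuppu h)
  have hv0 : ∀ t, t ∉ Icc (-R) R → v t = 0 := fun t ht ↦ by
    have : testCombination G.φ c t = 0 :=
      image_eq_zero_of_notMem_tsupport fun h ↦ ht (hsc h)
    simp [hvdef, this]
  set w : ℝ → ℝ := fun t ↦ v t - u t with hwdef
  have hw : IsWeilTest fun t ↦ (w t : ℂ) := by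
    have h := hv.sub hu
    convert h using 1
    funext t
    simp [hwdef]
  have hw0' : ∀ t, t ∉ Icc (-R) R → w t = 0 := fun t ht ↦ by simp [hwdef, hu0 t ht, hv0 t ht]
  have hw0 : ∀ t, |w t| ≤ ε := fun t ↦ by
    rw [hwdef, abs_sub_comm]; exact happ0 t
  have hud := differentiable_of_isWeilTest_ofReal hu
  have hvd := differentiable_of_isWeilTest_ofReal hv
  have hw1 : ∀ t, |deriv w t| ≤ ε := fun t ↦ by
    have hd : deriv w t = deriv v t - deriv u t := by
      rw [hwdef]; exact deriv_sub (hvd t) (hud t)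
    rw [hd, abs_sub_comm]
    exact happ1 t
  -- polarisation `Q(v) = Q(u) + Q(w) + 2 W(w ⋆ ũ)` (reality swap for the second cross term)
  have hsum : (fun t ↦ (v t : ℂ)) = (fun t ↦ (u t : ℂ)) + fun t ↦ (w t : ℂ) := by
    funext t
    simp [hwdef]
  have hpol := weilQuadratic_add hu hw
  rw [← hsum] at hpol
  have hswap : weilFunctional (weilConv (fun t ↦ (u t : ℂ)) (weilReflect fun t ↦ (w t : ℂ))) =
      weilFunctional (weilConv (fun t ↦ (w t : ℂ)) (weilReflect fun t ↦ (u t : ℂ))) :=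
    weilFunctional_weilConv_weilReflect_swap_of_real (u := fun t ↦ (w t : ℂ))
      (v := fun t ↦ (u t : ℂ)) (fun t ↦ Complex.conj_ofReal _) (fun t ↦ Complex.conj_ofReal _)
  rw [hswap] at hpol
  have hre : (weilQuadratic fun t ↦ (u t : ℂ)).re =
      (weilQuadratic fun t ↦ (v t : ℂ)).re - (weilQuadratic fun t ↦ (w t : ℂ)).re -
        2 * (weilFunctional (weilConv (fun t ↦ (w t : ℂ)) (weilReflect fun t ↦ (u t : ℂ)))).re := by
    have h := congrArg Complex.re hpol
    simp only [Complex.add_re] at h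
    linarith
  -- the two bounds
  have hcross : ‖weilFunctional (weilConv (fun t ↦ (w t : ℂ)) (weilReflect fun t ↦ (u t : ℂ)))‖ ≤
      C * (ε * Real.exp R * (2 * R)) :=
    (hC _ hw).trans (mul_le_mul_of_nonneg_left (weightedL1_le_of_window hR hw0' hw0) hC0)
  have hcre := Complex.abs_re_le_norm
    (weilFunctional (weilConv (fun t ↦ (w t : ℂ)) (weilReflect fun t ↦ (u t : ℂ))))
  have hquad : (weilQuadratic fun t ↦ (w t : ℂ)).re ≤ K * ε ^ 2 := hK w ε hw hw0' hw0 hw1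
  have hε2 : ε ^ 2 ≤ ε := by nlinarith
  -- contradiction: `-q = Re Q(u) ≥ -K ε² - 4 C R e^R ε > -q`
  have hlow : -(K * ε ^ 2) - 4 * C * R * Real.exp R * ε ≤ (weilQuadratic fun t ↦ (u t : ℂ)).re := by
    rw [hre]
    have h1 : (weilFunctional (weilConv (fun t ↦ (w t : ℂ)) (weilReflect fun t ↦ (u t : ℂ)))).re ≤
        ‖weilFunctional (weilConv (fun t ↦ (w t : ℂ)) (weilReflect fun t ↦ (u t : ℂ)))‖ :=
      (abs_le.1 hcre).2
    have h2 : 2 * ‖weilFunctional (weilConv (fun t ↦ (w t : ℂ)) (weilReflect fun t ↦ (u t : ℂ)))‖ ≤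
        4 * C * R * Real.exp R * ε :=
      calc 2 * ‖weilFunctional (weilConv (fun t ↦ (w t : ℂ)) (weilReflect fun t ↦ (u t : ℂ)))‖
          ≤ 2 * (C * (ε * Real.exp R * (2 * R))) := by linarith [hcross]
        _ = 4 * C * R * Real.exp R * ε := by ring
    have h3 : 0 ≤ (weilQuadratic fun t ↦ (v t : ℂ)).re := hQv
    have h4 : (weilQuadratic fun t ↦ (w t : ℂ)).re ≤ K * ε ^ 2 := hquad
    linarith [h1, h2, h3, h4]
  have hKε : K * ε ^ 2 ≤ K * ε := mul_le_mul_of_nonneg_left hε2 hK0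
  have : K * ε ^ 2 + 4 * C * R * Real.exp R * ε < q := by
    calc K * ε ^ 2 + 4 * C * R * Real.exp R * ε ≤ K * ε + 4 * C * R * Real.exp R * ε := by linarith
      _ = ε * L := by rw [hL]; ring
      _ < q := hεL
  linarith

/-- Hence **Weil positivity** (all complex test functions; `weilPositivity_iff_real`). -/
theorem weilPositivity_of_generatingFamily (G : GeneratingFamily)
    (hpos : ∀ c : G.ι →₀ ℤ, 0 ≤ (weilQuadratic fun t ↦ (testCombination G.φ c t : ℂ)).re) :
    WeilPositivity :=
  weilPositivity_iff_real.2 fun _ hu ↦ re_weilQuadratic_nonneg_of_generatingFamily G hpos hu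

/-- Hence the **Riemann Hypothesis** (Weil's criterion, `weil_criterion_holds`, PROVED in the tree). -/
theorem riemannHypothesis_of_generatingFamily (G : GeneratingFamily)
    (hpos : ∀ c : G.ι →₀ ℤ, 0 ≤ (weilQuadratic fun t ↦ (testCombination G.φ c t : ℂ)).re) :
    _root_.RiemannHypothesis :=
  (show _root_.RiemannHypothesis ↔ WeilPositivity from weil_criterion_holds).2
    (weilPositivity_of_generatingFamily G hpos)

/-- **RH ⟺ Weil positivity on the integer span of ANY generating family**: for every `C¹`-dense
family of real test functions, RH is equivalent to the countable list of prime-side inequalities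
`Re W(u_c ⋆ ũ_c) ≥ 0`, `c : G.ι →₀ ℤ`. -/
theorem riemannHypothesis_iff_nonneg_on_generatingFamily (G : GeneratingFamily) :
    _root_.RiemannHypothesis ↔
      ∀ c : G.ι →₀ ℤ, 0 ≤ (weilQuadratic fun t ↦ (testCombination G.φ c t : ℂ)).re :=
  ⟨fun h c ↦ (show _root_.RiemannHypothesis ↔ WeilPositivity from weil_criterion_holds).1 h _
      (G.isWeilTest_testCombination c),
    riemannHypothesis_of_generatingFamily G⟩

/-- **RH ⟺ Castelnuovo–Severi for the countably many divisors `D(f_c)`** (Connes–Consani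
normalisation, `f_c = toMul u_c`): `2 𝔰(f_c, f_c) ≤ 2 (∫ f_c d*u)(∫ f_c du)` for all `c : G.ι →₀ ℤ`. -/
theorem riemannHypothesis_iff_castelnuovoSeveri_on_generatingFamily (G : GeneratingFamily) :
    _root_.RiemannHypothesis ↔ ∀ c : G.ι →₀ ℤ,
      2 * ccPairing (toMul (testCombination G.φ c)) (toMul (testCombination G.φ c)) ≤
        2 * (massDstar (toMul (testCombination G.φ c)) * massDu (toMul (testCombination G.φ c))) := by
  rw [riemannHypothesis_iff_nonneg_on_generatingFamily G]
  exact forall_congr' fun c ↦ (ccPairing_le_masses_iff (G.isWeilTest_testCombination c)).symm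

end Summit.RiemannHypothesis.RiemannHypothesis.Theorems.MotivicDoor.AWS

end
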